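import Literature.AnabelianGeometry.AbsoluteAnabelian.NFDecompositionCommTerminalProofs
import Literature.AnabelianGeometry.AbsoluteAnabelian.NFDecompositionRelSlimProofs
import Mathlib.RingTheory.Valuation.LocalSubring
import HarnessLib

/-!
# A valuation ring of `K̄` over a given prime of `\bar ℤ_K`, and its decomposition group

Topic `NumberTheory/GaloisRepresentations`; namespace
`Literature.NumberTheory.GaloisRepresentations.ExplicitMuCocycles`.  Proof file: theorems only (no
definition, no instance, no named fact).

For a number field `K` and a prime `𝔓` of `\bar ℤ_K = absIntegers (𝓞 K) K` above a finite place `v`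
there is a valuation subring `A ≠ ⊤` of `K̄` CENTRED at `𝔓` (`s ∈ 𝔓 ↔ s` is a non-unit of `A`; Chevalley's
extension theorem, Mathlib `Ideal.image_subset_nonunits_valuationSubring`, plus maximality of `𝔓`), and
then `decompositionGroupNF K A = D_𝔓` (the tree's `decompositionGroupNF_eq_decompositionSubgroup`,
Serre *Local Fields* I §7).  This is the converse direction of the dictionary
`exists_ideal_mem_primesAbove_of_ne_top` (valuation rings ↦ primes) of
`NFDecompositionCommTerminalProofs.lean`, needed to read the decomposition subgroups
`(adicCompletionPrime K v).decompositionSubgroup Γ_K` of the explicit-cochain files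
(`NeukirchHasseNF`, `NeukirchFiniteSupportNF`, `NeukirchTwoPlaceNF`) as stabilisers of nonarchimedean
primes of `K̄` in the valuation-ring model of `NeukirchUchida.lean` (abc-iut GAP-LEDGER G-L4d2g4-1).

## References

* J.-P. Serre, *Local Fields* (1979), Ch. I §7 Prop. 19–21. [SerreLocalFields1979]
* J. Neukirch, *Algebraic Number Theory* (1999), Ch. II §8 (8.1). [NeukirchANT1999]
-/

noncomputable section

open Function Field IsDedekindDomain NumberField

namespace Literature.NumberTheory.GaloisRepresentations.ExplicitMuCocycles

open Literature.NumberTheory.GaloisRepresentations Literature.AnabelianGeometry.AbsoluteAnabelian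

variable (K : Type) [Field K] [NumberField K]

omit [NumberField K] in
/-- **A valuation ring of `K̄` centred at a maximal ideal of `\bar ℤ_K`** (Chevalley): for a maximal
ideal `𝔓` of `absIntegers (𝓞 K) K` there is a valuation subring `A` of `K̄` with
`s ∈ 𝔓 ↔ s ∈ 𝔪_A` for all `s ∈ \bar ℤ_K`. [cite: SerreLocalFields1979, Ch. I §7 Prop. 19–21] -/
theorem exists_valuationSubring_forall_mem_iff (𝔓 : Ideal (absIntegers (𝓞 K) K)) (h𝔓 : 𝔓.IsMaximal) :
    ∃ A : ValuationSubring (AlgebraicClosure K),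
      ∀ s : absIntegers (𝓞 K) K, s ∈ 𝔓 ↔ (s : AlgebraicClosure K) ∈ A.nonunits := by
  classical
  obtain ⟨A, hle, hsub⟩ := Ideal.image_subset_nonunits_valuationSubring
    (A := (absIntegers (𝓞 K) K).toSubring) 𝔓 h𝔓.ne_top
  refine ⟨A, fun s => ⟨fun hs => hsub ⟨s, hs, rfl⟩, fun hs => ?_⟩⟩
  -- if `s ∉ 𝔓`, maximality gives `a s + u = 1` with `u ∈ 𝔓`, and `s` is a unit of the local ring `A`
  by_contra hs𝔓
  obtain ⟨a, u, hu, hau⟩ := h𝔓.exists_inv hs𝔓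
  have huA : ((u : AlgebraicClosure K)) ∈ A.nonunits := hsub ⟨u, hu, rfl⟩
  set s' : A := ⟨(s : AlgebraicClosure K), hle s.2⟩ with hs'
  set a' : A := ⟨(a : AlgebraicClosure K), hle a.2⟩ with ha'
  set u' : A := ⟨(u : AlgebraicClosure K), hle u.2⟩ with hu'
  have hrel : a' * s' + u' = 1 := by
    apply Subtype.ext
    have := congrArg (fun x : absIntegers (𝓞 K) K => (x : AlgebraicClosure K)) hau
    simpa using this
  have hu'max : u' ∈ IsLocalRing.maximalIdeal A := A.coe_mem_nonunits_iff.mp huA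
  have has : IsUnit (a' * s') := by
    have h1 : a' * s' = 1 - u' := eq_sub_of_add_eq hrel
    rw [h1]
    exact IsLocalRing.isUnit_one_sub_self_of_mem_nonunits u' hu'max
  have hsunit : IsUnit s' := isUnit_of_mul_isUnit_right has
  exact (A.coe_mem_nonunits_iff.mp hs) hsunit

/-- **The decomposition group of a prime of `\bar ℤ_K` is the stabiliser of a nonarchimedean prime
of `K̄`**: for `𝔓 ∈ v.primesAbove` there is a valuation subring `A ≠ ⊤` of `K̄` centred at `𝔓` with
`decompositionGroupNF K A = D_𝔓`. [cite: SerreLocalFields1979, Ch. I §7 Prop. 19–21] -/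
theorem exists_valuationSubring_decompositionGroupNF_eq {v : HeightOneSpectrum (𝓞 K)}
    {𝔓 : Ideal (absIntegers (𝓞 K) K)} (h𝔓 : 𝔓 ∈ v.primesAbove) :
    ∃ A : ValuationSubring (AlgebraicClosure K), A ≠ ⊤ ∧
      (∀ s : absIntegers (𝓞 K) K, s ∈ 𝔓 ↔ (s : AlgebraicClosure K) ∈ A.nonunits) ∧
      decompositionGroupNF K A = 𝔓.decompositionSubgroup (absoluteGaloisGroup K) := by
  obtain ⟨A, hA⟩ := exists_valuationSubring_forall_mem_iff K 𝔓
    (HeightOneSpectrum.isMaximal_of_mem_primesAbove h𝔓)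
  refine ⟨A, fun htop => ?_, hA, decompositionGroupNF_eq_decompositionSubgroup A 𝔓 hA⟩
  -- `A = ⊤` has no non-zero non-units, but `𝔓 ∋ p ≠ 0`
  obtain ⟨p, hp, hpv⟩ := exists_prime_natCast_mem_asIdeal v
  have hover := (HeightOneSpectrum.mem_primesAbove_iff.mp h𝔓).2.over
  have hp𝔓 : ((p : ℕ) : absIntegers (𝓞 K) K) ∈ 𝔓 := by
    have h1 : ((p : ℕ) : 𝓞 K) ∈ 𝔓.under (𝓞 K) := hover ▸ hpv
    rw [Ideal.under_def, Ideal.mem_comap, map_natCast] at h1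
    exact h1
  have hpA : ((p : ℕ) : AlgebraicClosure K) ∈ A.nonunits := by
    have h := (hA _).mp hp𝔓
    simpa using h
  rw [htop, ValuationSubring.mem_nonunits_iff_or] at hpA
  rcases hpA with h0 | hinv
  · exact (Nat.cast_ne_zero.mpr hp.ne_zero : ((p : ℕ) : AlgebraicClosure K) ≠ 0) h0
  · exact hinv (ValuationSubring.mem_top _)

end Literature.NumberTheory.GaloisRepresentations.ExplicitMuCocycles

end
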